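import Literature.Analysis.FunctionSpaces.ContDiffHolderLeibniz
import Literature.Analysis.FunctionSpaces.ContDiffHolderClosedGraph
import HarnessLib

/-!
# The derivative as a bounded operator `C^{k+1,r}_b → C^{k,r}_b` (Hölder spaces, part 12)

Topic `Literature/Analysis/FunctionSpaces`. On the Banach spaces `C^{k,r}_b(E, F)` of part 3 the
Fréchet derivative is a bounded linear operator
`fderivCLM : C^{k+1,r}_b(E, F) →L[ℝ] C^{k,r}_b(E, E →L[ℝ] F)` (membership: the derivative shift
`MemContDiffHolder.fderiv` of part 6; continuity: closed graph, part 9, the point evaluations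
`u ↦ Du(x)` being bounded by `‖u‖_{C^{k+1,r}}`), and so are the directional derivatives
`u ↦ (x ↦ Du(x) v)` and the second derivative `u ↦ D²u = D(Du)`,
`C^{k+2,r}_b(E, F) →L[ℝ] C^{k,r}_b(E, E →L[ℝ] E →L[ℝ] F)`. These are the jet maps through which
(non)linear differential operators act on Hölder spaces (Gilbarg–Trudinger 2001, §6.1: "`L` is a
bounded operator from `C^{2,α}` to `C^{α}`"). Everything is proved; no named facts. Brick (1d-ii-0)
of the census of `Literature.Geometry.Riemannian.gurskyViaclovsky_pathOpen_weighted_four`.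

## References

* D. Gilbarg, N. S. Trudinger, *Elliptic Partial Differential Equations of Second Order* (2001),
  §6.1. [GilbargTrudinger2001]
-/

noncomputable section

open Set Filter Topology
open scoped NNReal

namespace Literature.Analysis.FunctionSpaces

namespace ContDiffHolderFunction

variable {E F : Type*} [NormedAddCommGroup E] [NormedSpace ℝ E] [NormedAddCommGroup F]
  [NormedSpace ℝ F] {k : ℕ} {r : ℝ≥0}

/-- The derivative of a member of `C^{k+1,r}_b` as a member of `C^{k,r}_b`. [folklore] -/
def fderivFun (u : ContDiffHolderFunction E F (k + 1) r) : ContDiffHolderFunction E (E →L[ℝ] F) k r :=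
  ⟨fderiv ℝ u, u.memContDiffHolder.fderiv⟩

/-- Pointwise: `fderivFun u x = Du(x)`. [folklore] -/
@[simp]
theorem fderivFun_apply (u : ContDiffHolderFunction E F (k + 1) r) (x : E) :
    fderivFun u x = fderiv ℝ (u : E → F) x := rfl

/-- `fderivFun` is additive (the members are differentiable). [folklore] -/
theorem fderivFun_add (u v : ContDiffHolderFunction E F (k + 1) r) :
    fderivFun (u + v) = fderivFun u + fderivFun v := by
  refine ContDiffHolderFunction.ext fun x => ?_
  simp only [fderivFun_apply, coe_add, Pi.add_apply]
  exact fderiv_add (u.contDiff.differentiable (by exact_mod_cast Nat.succ_ne_zero k) x)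
    (v.contDiff.differentiable (by exact_mod_cast Nat.succ_ne_zero k) x)

/-- `fderivFun` is real-homogeneous. [folklore] -/
theorem fderivFun_smul (a : ℝ) (u : ContDiffHolderFunction E F (k + 1) r) :
    fderivFun (a • u) = a • fderivFun u := by
  refine ContDiffHolderFunction.ext fun x => ?_
  simp only [fderivFun_apply, coe_smul, Pi.smul_apply]
  exact fderiv_const_smul (u.contDiff.differentiable (by exact_mod_cast Nat.succ_ne_zero k) x) a

/-- The derivative as a linear map. [folklore] -/
def fderivₗ : ContDiffHolderFunction E F (k + 1) r →ₗ[ℝ] ContDiffHolderFunction E (E →L[ℝ] F) k r where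
  toFun := fderivFun
  map_add' := fderivFun_add
  map_smul' := fderivFun_smul

/-- **Point evaluations of the derivative are bounded**: `‖Du(x)‖ ≤ ‖u‖_{C^{k+1,r}}`. [folklore] -/
theorem norm_fderiv_apply_le (u : ContDiffHolderFunction E F (k + 1) r) (x : E) :
    ‖fderiv ℝ (u : E → F) x‖ ≤ ‖u‖ := by
  have h := u.norm_iteratedFDeriv_le_norm (j := 1) (by omega) x
  rwa [norm_iteratedFDeriv_one] at h

variable [CompleteSpace F]

/-- **The derivative is a bounded operator** `C^{k+1,r}_b(E, F) →L[ℝ] C^{k,r}_b(E, E →L[ℝ] F)`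
(closed graph: the evaluations `u ↦ Du(x)` are bounded). [cite: GilbargTrudinger2001, §6.1] -/
def fderivCLM : ContDiffHolderFunction E F (k + 1) r →L[ℝ] ContDiffHolderFunction E (E →L[ℝ] F) k r :=
  clmOfContinuousEval fderivₗ fun x => by
    let ev : ContDiffHolderFunction E F (k + 1) r →ₗ[ℝ] (E →L[ℝ] F) :=
      { toFun := fun u => fderiv ℝ (u : E → F) x
        map_add' := fun u v => by
          have h := congrArg (fun w : ContDiffHolderFunction E (E →L[ℝ] F) k r => w x)
            (fderivFun_add u v)
          simpa using h
        map_smul' := fun a u => by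
          have h := congrArg (fun w : ContDiffHolderFunction E (E →L[ℝ] F) k r => w x)
            (fderivFun_smul a u)
          simpa using h }
    have hev : Continuous ev :=
      AddMonoidHomClass.continuous_of_bound ev 1 fun u => by
        rw [one_mul]
        exact norm_fderiv_apply_le u x
    exact hev

/-- Pointwise: `fderivCLM u x = Du(x)`. [folklore] -/
@[simp]
theorem fderivCLM_apply (u : ContDiffHolderFunction E F (k + 1) r) (x : E) :
    fderivCLM u x = fderiv ℝ (u : E → F) x := rfl

end ContDiffHolderFunction

/-! ### Post-composition with a continuous linear map -/

section PostComp

variable {E F G : Type*} [NormedAddCommGroup E] [NormedSpace ℝ E] [NormedAddCommGroup F]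
  [NormedSpace ℝ F] [NormedAddCommGroup G] [NormedSpace ℝ G] {k : ℕ} {r : ℝ≥0}

/-- **Post-composition with a continuous linear map preserves `C^{k,r}_b`**
(`‖L ∘ f‖_{C^{k,r}} ≤ ‖L‖ ‖f‖_{C^{k,r}}`, `eContDiffHolderNorm_clm_comp_le`). [folklore] -/
theorem MemContDiffHolder.clm_comp (L : F →L[ℝ] G) {f : E → F} (hf : MemContDiffHolder k r f) :
    MemContDiffHolder k r fun x => L (f x) :=
  MemContDiffHolder.of_eContDiffHolderNorm_lt_top (L.contDiff.comp hf.1)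
    (lt_of_le_of_lt (eContDiffHolderNorm_clm_comp_le L hf.1 r)
      (ENNReal.mul_lt_top enorm_lt_top hf.eContDiffHolderNorm_lt_top))

namespace ContDiffHolderFunction

/-- Post-composition with a continuous linear map, as a linear map of Hölder spaces. [folklore] -/
def postcompₗ (L : F →L[ℝ] G) : ContDiffHolderFunction E F k r →ₗ[ℝ] ContDiffHolderFunction E G k r where
  toFun f := ⟨fun x => L (f x), f.memContDiffHolder.clm_comp L⟩
  map_add' f g := ContDiffHolderFunction.ext fun x => by simp
  map_smul' a f := ContDiffHolderFunction.ext fun x => by simp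

/-- **Post-composition with a continuous linear map is a bounded operator**
`C^{k,r}_b(E, F) →L[ℝ] C^{k,r}_b(E, G)` (closed graph). [folklore] -/
def postcompCLM [CompleteSpace F] [CompleteSpace G] (L : F →L[ℝ] G) :
    ContDiffHolderFunction E F k r →L[ℝ] ContDiffHolderFunction E G k r :=
  clmOfContinuousEval (postcompₗ L) fun x =>
    L.continuous.comp (evalCLM (E := E) (F := F) (k := k) (r := r) x).continuous

/-- Pointwise: `postcompCLM L f x = L (f x)`. [folklore] -/
@[simp]
theorem postcompCLM_apply [CompleteSpace F] [CompleteSpace G] (L : F →L[ℝ] G)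
    (f : ContDiffHolderFunction E F k r)
    (x : E) : postcompCLM L f x = L (f x) := rfl

end ContDiffHolderFunction

end PostComp

/-! ### Directional and second derivatives -/

namespace ContDiffHolderFunction

variable {E F : Type*} [NormedAddCommGroup E] [NormedSpace ℝ E] [NormedAddCommGroup F]
  [NormedSpace ℝ F] [CompleteSpace F] {k : ℕ} {r : ℝ≥0}

/-- **Directional derivatives are bounded operators** `C^{k+1,r}_b(E, F) →L[ℝ] C^{k,r}_b(E, F)`,
`u ↦ (x ↦ Du(x) v)`. [cite: GilbargTrudinger2001, §6.1] -/
def fderivApplyCLM (v : E) : ContDiffHolderFunction E F (k + 1) r →L[ℝ] ContDiffHolderFunction E F k r :=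
  (postcompCLM (ContinuousLinearMap.apply ℝ F v)).comp fderivCLM

/-- Pointwise: `fderivApplyCLM v u x = Du(x) v`. [folklore] -/
@[simp]
theorem fderivApplyCLM_apply (v : E) (u : ContDiffHolderFunction E F (k + 1) r) (x : E) :
    fderivApplyCLM v u x = fderiv ℝ (u : E → F) x v := rfl

/-- **The second derivative is a bounded operator**
`C^{k+2,r}_b(E, F) →L[ℝ] C^{k,r}_b(E, E →L[ℝ] E →L[ℝ] F)`, `u ↦ D(Du)`. [cite: GilbargTrudinger2001, §6.1] -/
def fderiv₂CLM : ContDiffHolderFunction E F (k + 2) r →L[ℝ]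
    ContDiffHolderFunction E (E →L[ℝ] E →L[ℝ] F) k r :=
  (fderivCLM (E := E) (F := E →L[ℝ] F) (k := k) (r := r)).comp
    (fderivCLM (E := E) (F := F) (k := k + 1) (r := r))

/-- Pointwise: `fderiv₂CLM u x = D(Du)(x)`. [folklore] -/
@[simp]
theorem fderiv₂CLM_apply (u : ContDiffHolderFunction E F (k + 2) r) (x : E) :
    fderiv₂CLM u x = fderiv ℝ (fderiv ℝ (u : E → F)) x := rfl

/-- **Second directional derivatives are bounded operators** `C^{k+2,r}_b(E, F) →L[ℝ] C^{k,r}_b(E, F)`,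
`u ↦ (x ↦ D²u(x)(v, w))`. [folklore] -/
def fderiv₂ApplyCLM (v w : E) :
    ContDiffHolderFunction E F (k + 2) r →L[ℝ] ContDiffHolderFunction E F k r :=
  (postcompCLM ((ContinuousLinearMap.apply ℝ F w).comp (ContinuousLinearMap.apply ℝ (E →L[ℝ] F) v))).comp
    fderiv₂CLM

/-- Pointwise: `fderiv₂ApplyCLM v w u x = D(Du)(x) v w`. [folklore] -/
@[simp]
theorem fderiv₂ApplyCLM_apply (v w : E) (u : ContDiffHolderFunction E F (k + 2) r) (x : E) :
    fderiv₂ApplyCLM v w u x = fderiv ℝ (fderiv ℝ (u : E → F)) x v w := rfl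

end ContDiffHolderFunction

end Literature.Analysis.FunctionSpaces

end
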